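import Summits.AtomisticToContinuum.Crystallization.Theses.BrittleMieDescent

/-!
# Refutation of `BrittleMieDescent.EffectiveLocalHales` (stmt-AtomisticToContinuum-4146)

`EffectiveLocalHales` (route `AtomisticToContinuum/Crystallization/BrittleMieDescent`, crux, rank 6)
claims: if `u ∈ S ⊆ ℝ³` and every point of `S` within `1.01` of `u` is *softly twelve-kissed* with
tolerance `1/100` and Hales gap `63/50` (all other points of `S` at distance `≥ 0.99`, each either
`≤ 1.01` or `≥ 1.26` away, exactly twelve within `1.01`), then the soft contact graph on the twelve
neighbours of `u` is isomorphic to the contact graph of the FCC or of the HCP kissing pattern.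

**It is false at tolerance `1/100`: the decahedral-axis (`D₅ₕ`, bicapped pentagonal prism) shell.**
Five regular tetrahedra around a common edge leave the classical gap `2π − 5·arccos(1/3) ≈ 7.36°`;
stretching the shared edge to `1 + η` and shrinking the other edges to `1 − η` closes the ring as
soon as `η ≳ 0.0067 < 1/100`.  Witness (coordinates in units of `1/1000`, centre `u = 0`): poles
`(0, 0, ±1005)`, two *aligned* pentagonal rings of radius `0.856` at heights `±0.503`.  Contacts:
pole–ring `0.992`, ring–ring `1.006`, ring–ring vertical `1.007`; every other pair of the thirteen
points is `≥ 1.42` apart; radii `0.993` (rings), `1.005` (poles).  The soft contact graph of the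
shell has the two poles of degree `5` (25 edges), whereas both pattern graphs are `4`-regular
(24 edges) — so no isomorphism onto either pattern exists.  Since the hypothesis only constrains the
points within `1.01` of `u`, each shell point is topped up to exactly twelve soft contacts by `27`
second-shell points (the ten outer tetrahedral apices over the cap triangles, two axial points at
`±2.005`, two points on the outward axis of each of the five belt squares, and `aₖ + bₖ` for the five
vertical bonds), all `≥ 1.39` from `u` and never at distance `< 0.99` or in `(1.01, 1.26)` from any
of the thirteen cluster points.  All metric facts are integer inequalities on squared distances
(thresholds `990²`, `1010²`, `1260²`), certified by `decide`; the transfer to `ℝ³` goes through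
`Literature.Geometry.DiscreteGeometry.intVec` / `norm_intVec`, and the `4`-regularity of the patterns
through their integer models `fccInt` / `hcpInt`.

Threshold information for the planner: this witness family exists exactly for
`(2 sin 36°)² ((1−η)² − (1+η)²/4) ≤ (1+η)²`, i.e. `η ≥ η⋆ ≈ 0.0067`; at `η = 1/300` it is gone (other
families not excluded).  All auxiliary facts are `have`s inside the single theorem (refuter files
carry negations only).  Refuter refute-pool-g42-18, 2026-08-15.
-/

noncomputable section

namespace Summit.AtomisticToContinuum.Crystallization.Theorems

open Literature.Geometry.DiscreteGeometry

/-- Refutes `BrittleMieDescent.EffectiveLocalHales` (stmt-AtomisticToContinuum-4146): the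
`40`-point configuration "decahedral-axis shell of `u = 0` (poles `(0,0,±1.005)`, two aligned
pentagonal rings of radius `0.856` at heights `±0.503`) plus `27` second-shell points" satisfies the
soft twelve-kissing hypothesis with tolerance `1/100` and gap `63/50` at `u` and at its twelve
neighbours, but the poles have five soft contacts in the shell while every point of the FCC and of
the HCP pattern has at most four pattern points at distance `1`. Witness: five strained tetrahedra
close up around a bond at `0.67 %` strain. [folklore] -/
theorem BrittleMieDescentEffectiveLocalHales_refuted :
    ¬ Summit.AtomisticToContinuum.Crystallization.Theses.BrittleMieDescent.EffectiveLocalHales := by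
  intro hELH
  /- (1) both patterns are `4`-regular at contact distance (integer models). -/
  have hfcc4 : ∀ v ∈ fccInt,
      (fccInt.filter fun w => sqNormInt (v - w) = ((2 : ℕ) : ℤ)).card ≤ 4 := by decide
  have hhcp4 : ∀ v ∈ hcpInt,
      (hcpInt.filter fun w => sqNormInt (v - w) = ((18 : ℕ) : ℤ)).card ≤ 4 := by decide
  /- (2) the integer certificate of the witness (units of `1/1000`; index `0` is the centre `u`,
  `1, 2` the poles, `3, 5, 7, 9, 11` the upper ring, `4, …, 12` the lower ring, `13 …` padding). -/
  obtain ⟨T, hinj, hsep, hcnt, hN, r, hr_inj, hr_ne, hring⟩ :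
      ∃ T : Fin 40 → Fin 3 → ℤ,
        (∀ i j : Fin 40, sqNormInt (T i - T j) = 0 → i = j) ∧
        (∀ i : Fin 40, sqNormInt (T 0 - T i) ≤ 1020100 → ∀ j : Fin 40, j ≠ i →
            980100 ≤ sqNormInt (T i - T j) ∧
              (sqNormInt (T i - T j) ≤ 1020100 ∨ 1587600 ≤ sqNormInt (T i - T j))) ∧
        (∀ i : Fin 40, sqNormInt (T 0 - T i) ≤ 1020100 →
            (Finset.univ.filter fun j : Fin 40 =>
              j ≠ i ∧ sqNormInt (T i - T j) ≤ 1020100).card = 12) ∧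
        sqNormInt (T 0 - T 1) ≤ 1020100 ∧
        ∃ r : Fin 5 → Fin 40,
          (∀ k k' : Fin 5, r k = r k' → k = k') ∧
          (∀ k : Fin 5, r k ≠ 0 ∧ r k ≠ 1) ∧
          (∀ k : Fin 5, sqNormInt (T 0 - T (r k)) ≤ 1020100 ∧
            sqNormInt (T 1 - T (r k)) ≤ 1020100) :=
    ⟨![![0, 0, 0], ![0, 0, 1005], ![0, 0, -1005],
       ![856, 0, 503], ![856, 0, -503], ![265, 814, 503], ![265, 814, -503],
       ![-693, 503, 503], ![-693, 503, -503], ![-693, -503, 503], ![-693, -503, -503],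
       ![265, -814, 503], ![265, -814, -503],
       ![773, 561, 1318], ![773, -561, 1318], ![-295, 909, 1317], ![-955, 0, 1318],
       ![-295, -909, 1317], ![773, 561, -1318], ![773, -561, -1318], ![-295, 909, -1317],
       ![-955, 0, -1318], ![-295, -909, -1317],
       ![0, 0, 2005], ![0, 0, -2005],
       ![1126, 817, 0], ![1133, 822, 0], ![-430, 1322, 0], ![-432, 1331, 0], ![-1392, 0, 0],
       ![-1400, 0, 0], ![-430, -1322, 0], ![-432, -1331, 0], ![1126, -817, 0], ![1133, -822, 0],
       ![1712, 0, 0], ![530, 1628, 0], ![-1386, 1006, 0], ![-1386, -1006, 0], ![530, -1628, 0]],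
      by decide, by decide, by decide, by decide, ![3, 5, 7, 9, 11], by decide, by decide, by decide⟩
  have h10 : (1 : Fin 40) ≠ 0 := by decide
  /- (3) the real points `pt i = T i / 1000`. -/
  obtain ⟨pt, hpt⟩ : ∃ pt : Fin 40 → EuclideanSpace ℝ (Fin 3),
      ∀ i, pt i = (1000 : ℝ)⁻¹ • intVec (T i) := ⟨_, fun _ => rfl⟩
  have hnn : ∀ v : Fin 3 → ℤ, (0 : ℝ) ≤ (sqNormInt v : ℝ) := by
    intro v
    have h : (0 : ℤ) ≤ sqNormInt v := by unfold sqNormInt; positivity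
    exact_mod_cast h
  have hdist : ∀ i j, dist (pt i) (pt j) = (1000 : ℝ)⁻¹ * Real.sqrt (sqNormInt (T i - T j) : ℝ) := by
    intro i j
    rw [hpt, hpt, dist_eq_norm, ← smul_sub, intVec_sub, norm_smul, norm_inv,
      Real.norm_of_nonneg (by norm_num : (0 : ℝ) ≤ 1000), norm_intVec]
  have hle : ∀ (i j : Fin 40) (c : ℝ), 0 ≤ c →
      (dist (pt i) (pt j) ≤ c ↔ (sqNormInt (T i - T j) : ℝ) ≤ (1000 * c) ^ 2) := by
    intro i j c hc
    rw [hdist, inv_mul_le_iff₀ (by norm_num : (0 : ℝ) < 1000),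
      Real.sqrt_le_left (mul_nonneg (by norm_num) hc)]
  have hge : ∀ (i j : Fin 40) (c : ℝ), 0 ≤ c →
      (c ≤ dist (pt i) (pt j) ↔ (1000 * c) ^ 2 ≤ (sqNormInt (T i - T j) : ℝ)) := by
    intro i j c hc
    rw [hdist, le_inv_mul_iff₀ (by norm_num : (0 : ℝ) < 1000),
      Real.le_sqrt (mul_nonneg (by norm_num) hc) (hnn _)]
  have hle1 : ∀ i j, dist (pt i) (pt j) ≤ 1 + 1 / 100 ↔ sqNormInt (T i - T j) ≤ 1020100 := by
    intro i j
    rw [hle i j _ (by norm_num), show ((1000 : ℝ) * (1 + 1 / 100)) ^ 2 = ((1020100 : ℤ) : ℝ) by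
      norm_num, Int.cast_le]
  have hge1 : ∀ i j, 1 - 1 / 100 ≤ dist (pt i) (pt j) ↔ 980100 ≤ sqNormInt (T i - T j) := by
    intro i j
    rw [hge i j _ (by norm_num), show ((1000 : ℝ) * (1 - 1 / 100)) ^ 2 = ((980100 : ℤ) : ℝ) by
      norm_num, Int.cast_le]
  have hge2 : ∀ i j, 63 / 50 ≤ dist (pt i) (pt j) ↔ 1587600 ≤ sqNormInt (T i - T j) := by
    intro i j
    rw [hge i j _ (by norm_num), show ((1000 : ℝ) * (63 / 50)) ^ 2 = ((1587600 : ℤ) : ℝ) by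
      norm_num, Int.cast_le]
  have hpt_inj : ∀ i j, pt i = pt j → i = j := by
    intro i j h
    apply hinj
    rw [hpt, hpt] at h
    have h' : intVec (T i) = intVec (T j) :=
      (smul_right_injective (EuclideanSpace ℝ (Fin 3)) (by norm_num : (1000 : ℝ)⁻¹ ≠ 0)) h
    have h'' : T i = T j := intVec_injective h'
    rw [h'', sub_self]
    simp [sqNormInt]
  /- (4) the hypothesis of `EffectiveLocalHales` holds for `S = range pt`, `u = pt 0`. -/
  have hyp : ∀ v ∈ Set.range pt, dist (pt 0) v ≤ 1 + 1 / 100 →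
      ((∀ w ∈ Set.range pt, w ≠ v →
          1 - 1 / 100 ≤ dist v w ∧ (dist v w ≤ 1 + 1 / 100 ∨ 63 / 50 ≤ dist v w)) ∧
        {w ∈ Set.range pt | w ≠ v ∧ dist v w ≤ 1 + 1 / 100}.ncard = 12) := by
    rintro v ⟨i, rfl⟩ hi
    rw [hle1] at hi
    refine ⟨?_, ?_⟩
    · rintro w ⟨j, rfl⟩ hne
      have hji : j ≠ i := fun h => hne (by rw [h])
      obtain ⟨h1, h2⟩ := hsep i hi j hji
      refine ⟨(hge1 i j).2 h1, ?_⟩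
      rcases h2 with h2 | h2
      · exact Or.inl ((hle1 i j).2 h2)
      · exact Or.inr ((hge2 i j).2 h2)
    · have hset : {w ∈ Set.range pt | w ≠ pt i ∧ dist (pt i) w ≤ 1 + 1 / 100} =
          ((Finset.univ.filter fun j : Fin 40 =>
              j ≠ i ∧ sqNormInt (T i - T j) ≤ 1020100).image pt :
            Set (EuclideanSpace ℝ (Fin 3))) := by
        ext w
        simp only [Set.mem_setOf_eq, Set.mem_range, Finset.coe_image, Set.mem_image,
          Finset.mem_coe, Finset.mem_filter, Finset.mem_univ, true_and]
        constructor
        · rintro ⟨⟨j, rfl⟩, hne, hd⟩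
          exact ⟨j, ⟨fun h => hne (by rw [h]), (hle1 i j).1 hd⟩, rfl⟩
        · rintro ⟨j, ⟨hji, hd⟩, rfl⟩
          exact ⟨⟨j, rfl⟩, fun h => hji (hpt_inj j i h), (hle1 i j).2 hd⟩
      rw [hset, Set.ncard_coe_finset,
        Finset.card_image_of_injective _ (fun a b h => hpt_inj a b h), hcnt i hi]
  /- (5) apply the claim and refute both alternatives by counting contacts at the pole. -/
  have hmain := hELH (Set.range pt) (pt 0) ⟨0, rfl⟩ hyp
  have hmem : ∀ i : Fin 40, i ≠ 0 → sqNormInt (T 0 - T i) ≤ 1020100 →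
      pt i ∈ Set.range pt ∧ pt i ≠ pt 0 ∧ dist (pt 0) (pt i) ≤ 1 + 1 / 100 := fun i hi hd =>
    ⟨⟨i, rfl⟩, fun h => hi (hpt_inj i 0 h), (hle1 0 i).2 hd⟩
  have key : ∀ (Sint : Finset (Fin 3 → ℤ)) (Nn : ℕ), Nn ≠ 0 →
      (∀ v ∈ Sint, (Sint.filter fun w => sqNormInt (v - w) = (Nn : ℤ)).card ≤ 4) →
      ∀ e : {w : EuclideanSpace ℝ (Fin 3) //
              w ∈ Set.range pt ∧ w ≠ pt 0 ∧ dist (pt 0) w ≤ 1 + 1 / 100} ≃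
            {q : EuclideanSpace ℝ (Fin 3) // q ∈ scaledPattern Sint Nn},
        (∀ w w' : {w : EuclideanSpace ℝ (Fin 3) //
              w ∈ Set.range pt ∧ w ≠ pt 0 ∧ dist (pt 0) w ≤ 1 + 1 / 100},
            w ≠ w' → (dist w.1 w'.1 ≤ 1 + 1 / 100 ↔ dist (e w).1 (e w').1 = 1)) → False := by
    intro Sint Nn hNn hdeg e he
    -- the pole and the upper ring as elements of the shell subtype
    obtain ⟨P, hP⟩ : ∃ P : {w : EuclideanSpace ℝ (Fin 3) //
        w ∈ Set.range pt ∧ w ≠ pt 0 ∧ dist (pt 0) w ≤ 1 + 1 / 100}, P.1 = pt 1 :=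
      ⟨⟨pt 1, hmem 1 h10 hN⟩, rfl⟩
    obtain ⟨R, hR⟩ : ∃ R : Fin 5 → {w : EuclideanSpace ℝ (Fin 3) //
        w ∈ Set.range pt ∧ w ≠ pt 0 ∧ dist (pt 0) w ≤ 1 + 1 / 100}, ∀ k, (R k).1 = pt (r k) :=
      ⟨fun k => ⟨pt (r k), hmem (r k) (hr_ne k).1 (hring k).1⟩, fun _ => rfl⟩
    have hPR : ∀ k, P ≠ R k := by
      intro k h
      have h1 : pt 1 = pt (r k) := by rw [← hP, ← hR k, h]
      exact (hr_ne k).2 (hpt_inj _ _ h1).symm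
    have hRR : Function.Injective R := by
      intro k k' h
      have h1 : pt (r k) = pt (r k') := by rw [← hR k, ← hR k', h]
      exact hr_inj k k' (hpt_inj _ _ h1)
    have hd1 : ∀ k, dist (e P).1 (e (R k)).1 = 1 := by
      intro k
      refine (he P (R k) (hPR k)).1 ?_
      rw [hP, hR k]
      exact (hle1 1 (r k)).2 (hring k).2
    -- integer models of the images
    obtain ⟨v, hv, hvP⟩ := Finset.mem_image.1 (e P).2
    have hw : ∀ k, ∃ w ∈ Sint, (Real.sqrt Nn)⁻¹ • intVec w = (e (R k)).1 := fun k =>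
      Finset.mem_image.1 (e (R k)).2
    choose w hwS hwR using hw
    have hw_inj : Function.Injective w := by
      intro k k' h
      have h1 : (e (R k)).1 = (e (R k')).1 := by rw [← hwR k, ← hwR k', h]
      exact hRR (e.injective (Subtype.ext h1))
    have hpos : (0 : ℝ) < Real.sqrt Nn := Real.sqrt_pos.2 (by exact_mod_cast Nat.pos_of_ne_zero hNn)
    have hcontact : ∀ k, sqNormInt (v - w k) = (Nn : ℤ) := by
      intro k
      have h1 := hd1 k
      rw [← hvP, ← hwR k, dist_eq_norm, ← smul_sub, intVec_sub, norm_smul, norm_inv,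
        Real.norm_of_nonneg (Real.sqrt_nonneg _), norm_intVec, inv_mul_eq_one₀ hpos.ne',
        Real.sqrt_inj (Nat.cast_nonneg _) (hnn _)] at h1
      exact_mod_cast h1.symm
    have hsub : Finset.univ.image w ⊆ Sint.filter fun w' => sqNormInt (v - w') = (Nn : ℤ) := by
      intro x hx
      obtain ⟨k, -, rfl⟩ := Finset.mem_image.1 hx
      exact Finset.mem_filter.2 ⟨hwS k, hcontact k⟩
    have h5 : (Finset.univ.image w).card = 5 := by
      rw [Finset.card_image_of_injective _ hw_inj]
      simp
    have h45 := Finset.card_le_card hsub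
    have h4 := hdeg v hv
    omega
  rcases hmain with ⟨e, he⟩ | ⟨e, he⟩
  · exact key fccInt 2 two_ne_zero hfcc4 e he
  · exact key hcpInt 18 (by norm_num) hhcp4 e he

end Summit.AtomisticToContinuum.Crystallization.Theorems

end
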